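import Mathlib
import HarnessLib

/-!
# Stub `stub_dlogPotential` — crux `TorsionLogs.NeronTorsionSector`, line `registered` (block U5)

The dlog potential of the cocycle difference on a branch of the real Weierstrass cubic
`y² = f(x) = 4x³ − g₂x − g₃`. Data: an algebraic point `P₁ = (x₁, y₁)` with `y₁ ≠ 0`, the tangent
slope `L₁ = f′(x₁)/(2y₁)` and `2P₁ = (x₂, y₂)`; a branch `yb = ε√f` (`ε = ±1`); the chord with `P₁`
in REGULAR form (slope `sl = M(x)/(yb + y₁)`, `M(x) = 4x² + 4xx₁ + 4x₁² − g₂`, sum point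
`(X3, Y3)`), iterated once more (`sl3`, `(X33, Y33)`); the third-kind potentials `Qf`, `Qf3` of the
two translates; the polynomial `Pg = 4(x + 2x₁)(yb + y₁) − L₁M(x)` (`= g·(yb + y₁)²` for the
rational function `g = T₁/(x − x₁)²`, `T₁` the tangent line at `P₁`, divisor
`(−2P₁) + (O) − 2(−P₁)`); and
`G = Pg/(yb + y₁)² · √(x·X33)/X3`.

* `stub_dlogPotential` (the registered signature): (i) `G′ = G·(Qf3 − Qf)/yb` and `G ≠ 0` where the
  displayed quantities are non-degenerate; (ii) the norm identity `A² − B²f = −4(x − x₂)M²` for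
  `Pg = A + B·yb`; (iii) `A(x₂) = B(x₂)y₂`; (iv) `y₂² = f(x₂)`.
* `dlogPotential_chordStep`: ONE chord step in regular form commutes with the invariant vector
  field: if `(U, V)` moves with `U′ = V·k`, `V′ = ½f′(U)·k` and `V² = f(U)` at the point, then the
  sum point
  `(X, Y) = (U, V) ⊕ P₁` satisfies `Y² = f(X)`, `X′ = Y·k`, `Y′ = ½f′(X)·k` (translation invariance
  of `dx/y`, [Silverman, III.5.1]). Applied to `(x, yb)` with `k = 1/yb` and then to `(X3, Y3)` it
  gives `X3′ = Y3/yb` and `X33′ = Y33/yb`.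
* The residual identity `Pg′/Pg − 2yb′/(yb + y₁) = (sl3 − sl)/(2yb)`: both sides equal
  `−4(yb + y₁)²Y3/(y₁Pg·… )`, via `2(yb + y₁)²(X3 − x₁) = −y₁Pg`, `sl3(X3 − x₁) = Y3 − y₁`,
  `sl(X3 − x₁) = −Y3 − y₁` and one polynomial identity modulo `yb² = f(x)`, `y₁² = f(x₁)`,
  `2L₁y₁ = f′(x₁)` (explicit `linear_combination` certificates).
* `dlogPotential_assembly`: the bookkeeping of the logarithmic derivatives of the four factors
  of `G`.

References: J. H. Silverman, *The Arithmetic of Elliptic Curves* (2nd ed., 2009), III.2.3, III.5.1;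
S. Lang, *Fundamentals of Diophantine Geometry* (1983), Ch. 13 Thm 1.1; D. F. Lawden, *Elliptic
Functions and Applications* (1989), §6.8.
-/

noncomputable section

-- `Summit.KontsevichZagierPeriods.KontsevichZagierPeriods.…` is the tree's mandated layout (single-conjunct summit).
set_option linter.dupNamespace false

namespace Summit.KontsevichZagierPeriods.KontsevichZagierPeriods.Cruxes.NeronTorsionSector.Translation

/-! ### Helpers: the chord step and the assembly of logarithmic derivatives -/

/-- **Derivative of the chord numerator `M(U) = 4U² + 4Ux₁ + 4x₁² − g₂` along a path `U`.**
[folklore] -/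
theorem hasDerivAt_chordM (x₁ g₂ x U' : ℝ) (U : ℝ → ℝ) (hU : HasDerivAt U U' x) :
    HasDerivAt (fun t => 4 * U t ^ 2 + 4 * U t * x₁ + 4 * x₁ ^ 2 - g₂)
      ((8 * U x + 4 * x₁) * U') x := by
  refine (((((hU.fun_pow 2).const_mul 4).fun_add ((hU.const_mul 4).mul_const x₁)).add_const
    (4 * x₁ ^ 2)).sub_const g₂).congr_deriv ?_
  norm_num
  ring

/-- **One chord step in regular form commutes with the invariant vector field** (translation
invariance of `dx/y` on `y² = f(x) = 4x³ − g₂x − g₃`). If the point `(U, V)` moves with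
`U′ = V·k`, `V′ = ½(12U² − g₂)·k`, lies on the curve at the parameter `x` and `V + y₁ ≠ 0`, then for
the chord with `P₁ = (x₁, y₁)` in regular form — slope `s = M(U)/(V + y₁)`, sum point
`X = s²/4 − U − x₁`, `Y = −(V + s(X − U))` — one has `Y² = f(X)`, `X′ = Y·k` and
`Y′ = ½(12X² − g₂)·k`. The algebra reduces to the vanishing of
`α = 2sV − (U − x₁)s² − M(U)` (i.e. `f(U) − f(x₁) = (U − x₁)M(U)`).
[cite: SilvermanAEC2009, III.2.3 and III.5.1] -/
theorem dlogPotential_chordStep (g₂ g₃ x₁ y₁ k x : ℝ) (f U V s X Y : ℝ → ℝ)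
    (hf : ∀ t, f t = 4 * t ^ 3 - g₂ * t - g₃) (h1 : y₁ ^ 2 = f x₁)
    (hs : s = fun t => (4 * U t ^ 2 + 4 * U t * x₁ + 4 * x₁ ^ 2 - g₂) / (V t + y₁))
    (hX : X = fun t => s t ^ 2 / 4 - U t - x₁)
    (hY : Y = fun t => -(V t + s t * (X t - U t)))
    (hU : HasDerivAt U (V x * k) x)
    (hV : HasDerivAt V ((12 * U x ^ 2 - g₂) / 2 * k) x)
    (hon : V x ^ 2 = f (U x)) (hD : V x + y₁ ≠ 0) :
    Y x ^ 2 = f (X x) ∧ HasDerivAt X (Y x * k) x ∧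
      HasDerivAt Y ((12 * X x ^ 2 - g₂) / 2 * k) x := by
  have honU : V x ^ 2 = 4 * U x ^ 3 - g₂ * U x - g₃ := by rw [← hf]; exact hon
  have h1' : y₁ ^ 2 = 4 * x₁ ^ 3 - g₂ * x₁ - g₃ := by rw [← hf]; exact h1
  have hsx' : s x = (4 * U x ^ 2 + 4 * U x * x₁ + 4 * x₁ ^ 2 - g₂) / (V x + y₁) := by rw [hs]
  have hsx : s x * (V x + y₁) = 4 * U x ^ 2 + 4 * U x * x₁ + 4 * x₁ ^ 2 - g₂ := by
    rw [hsx']; exact div_mul_cancel₀ _ hD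
  have hXx : X x = s x ^ 2 / 4 - U x - x₁ := by rw [hX]
  have hYx : Y x = -(V x + s x * (X x - U x)) := by rw [hY]
  -- the key vanishing `α = 0`
  have hα : 2 * s x * V x - (U x - x₁) * s x ^ 2
      - (4 * U x ^ 2 + 4 * U x * x₁ + 4 * x₁ ^ 2 - g₂) = 0 := by
    have h : (V x + y₁) ^ 2 * (2 * s x * V x - (U x - x₁) * s x ^ 2
        - (4 * U x ^ 2 + 4 * U x * x₁ + 4 * x₁ ^ 2 - g₂)) = 0 := by
      linear_combination (4 * U x ^ 2 + 4 * U x * x₁ + 4 * x₁ ^ 2 - g₂) * honU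
        - (4 * U x ^ 2 + 4 * U x * x₁ + 4 * x₁ ^ 2 - g₂) * h1'
        + (2 * V x * (V x + y₁) - (U x - x₁) * (s x * (V x + y₁)
            + (4 * U x ^ 2 + 4 * U x * x₁ + 4 * x₁ ^ 2 - g₂))) * hsx
    exact (mul_eq_zero.mp h).resolve_left (pow_ne_zero 2 hD)
  -- (a) the sum point lies on the curve
  have honX : Y x ^ 2 = f (X x) := by
    rw [hf, hYx, hXx]
    linear_combination (s x ^ 2 / 4 - U x - x₁ - U x) * hα + honU
  -- derivative of the slope
  have hsd : HasDerivAt s (-2 * (X x - U x) * k) x := by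
    have h := (hasDerivAt_chordM x₁ g₂ x (V x * k) U hU).fun_div (hV.add_const y₁) hD
    rw [hs]
    refine h.congr_deriv ?_
    rw [div_eq_iff (pow_ne_zero 2 hD), hXx]
    linear_combination (2 * (2 * U x + x₁) * k) * honU - (2 * (2 * U x + x₁) * k) * h1'
      + (k / 2 * (s x * (V x + y₁) + (4 * U x ^ 2 + 4 * U x * x₁ + 4 * x₁ ^ 2 - g₂))) * hsx
  -- (b) derivative of the abscissa
  have hXd : HasDerivAt X (Y x * k) x := by
    have h := (((hsd.fun_pow 2).div_const 4).fun_sub hU).sub_const x₁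
    rw [hX]
    refine h.congr_deriv ?_
    rw [hYx]
    norm_num
    ring
  -- (c) derivative of the ordinate
  have hYd : HasDerivAt Y ((12 * X x ^ 2 - g₂) / 2 * k) x := by
    have h := (hV.fun_add (hsd.fun_mul (hXd.fun_sub hU))).fun_neg
    rw [hY]
    refine h.congr_deriv ?_
    rw [hYx, hXx]
    linear_combination k * hα
  exact ⟨honX, hXd, hYd⟩

/-- **Assembly of the logarithmic derivative of `G = P/D² · R/X`, `R = √(xZ)`.** With
`R′ = (Z + xV/w)/(2R)`, `X′ = Y/w` and the residual identity in the solved form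
`s₃ = s + 2w(P′/P − 2w′/D)`, the derivative of `G` given by the quotient/product rules equals
`G · ((s₃/2 + V/(2Z) − Y/(2X)) − (s/2 + Y/(2X) − w/(2x)))/w`. Pure field identity. [folklore] -/
theorem dlogPotential_assembly (P P' D w w' R Z V X Y s s₃ x : ℝ) (hP : P ≠ 0) (hD : D ≠ 0)
    (hw : w ≠ 0) (hR : R ≠ 0) (hX : X ≠ 0) (hx : x ≠ 0) (hRZ : R ^ 2 = x * Z)
    (hs₃ : s₃ = s + 2 * w * (P' / P - 2 * w' / D)) :
    (((P' * D ^ 2 - P * (2 * D * w')) / (D ^ 2) ^ 2 * R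
        + P / D ^ 2 * ((1 * Z + x * (V * w⁻¹)) / (2 * R))) * X
        - P / D ^ 2 * R * (Y * w⁻¹)) / X ^ 2
      = P / D ^ 2 * R / X
        * ((s₃ / 2 + V / (2 * Z) - Y / (2 * X) - (s / 2 + Y / (2 * X) - w / (2 * x))) / w) := by
  subst hs₃
  have hZ : Z = R ^ 2 / x := by rw [hRZ]; field_simp
  subst hZ
  field_simp
  ring

/-! ### The registered stub -/

/-- **STUB U5 (`stub_dlogPotential`) — the dlog potential of the cocycle difference on a branch.**
On `y² = f(x) = 4x³ − g₂x − g₃` with `P₁ = (x₁, y₁)`, `y₁ ≠ 0`, `L₁ = f′(x₁)/(2y₁)`,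
`2P₁ = (x₂, y₂)` (tangent), a branch `yb = ε√f`, the regular-form chord `(X3, Y3) = (x, yb) ⊕ P₁`
(slope `sl = M(x)/(yb + y₁)`), the iterated chord `(X33, Y33) = (X3, Y3) ⊕ P₁` (slope `sl3`), the
potentials
`Qf = sl/2 + Y3/(2X3) − yb/(2x)` and `Qf3` (the same at `(X3, Y3)`), `Pg = 4(x + 2x₁)y₁ − L₁M(x)
+ 4(x + 2x₁)yb` and `G = Pg/(yb + y₁)² · √(x·X33)/X3`:
(i) where `f x > 0`, `yb + y₁ ≠ 0`, `Y3 + y₁ ≠ 0`, `X3 > 0`, `X33 > 0`, `x > 0`, `Pg ≠ 0`: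
`G′ = G·(Qf3 − Qf)/yb` and `G ≠ 0` (logarithmic derivatives of the factors, `X3′ = Y3/yb` and
`X33′ = Y33/yb` by `dlogPotential_chordStep` applied twice, and the residual identity
`Pg′/Pg − 2yb′/(yb + y₁) = (sl3 − sl)/(2yb)`, proved through `2(yb + y₁)²(X3 − x₁) = −y₁Pg`,
`(sl3 − sl)(X3 − x₁) = 2Y3` and an explicit polynomial certificate); (ii) the norm identity
`A² − B²f = −4(x − x₂)M(x)²` for `Pg = A + B·yb`; (iii) `A(x₂) = B(x₂)y₂`; (iv) `y₂² = f(x₂)`.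
[cite: Lang1983, Ch. 13 Thm 1.1] [cite: SilvermanAEC2009, III.2.3] -/
theorem stub_dlogPotential :
    ∀ (g₂ g₃ x₁ y₁ x₂ y₂ L₁ ε : ℝ) (f yb sl X3 Y3 Qf sl3 X33 Y33 Qf3 Pg G : ℝ → ℝ),
    (∀ x, f x = 4 * x ^ 3 - g₂ * x - g₃) → y₁ ^ 2 = f x₁ → y₁ ≠ 0 → (ε = 1 ∨ ε = -1) →
    L₁ = (12 * x₁ ^ 2 - g₂) / (2 * y₁) → x₂ = L₁ ^ 2 / 4 - 2 * x₁ → y₂ = -(y₁ + L₁ * (x₂ - x₁)) →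
    yb = (fun x => ε * Real.sqrt (f x)) →
    sl = (fun x => (4 * x ^ 2 + 4 * x * x₁ + 4 * x₁ ^ 2 - g₂) / (yb x + y₁)) →
    X3 = (fun x => sl x ^ 2 / 4 - x - x₁) →
    Y3 = (fun x => -(yb x + sl x * (X3 x - x))) →
    Qf = (fun x => sl x / 2 + Y3 x / (2 * X3 x) - yb x / (2 * x)) →
    sl3 = (fun x => (4 * X3 x ^ 2 + 4 * X3 x * x₁ + 4 * x₁ ^ 2 - g₂) / (Y3 x + y₁)) →
    X33 = (fun x => sl3 x ^ 2 / 4 - X3 x - x₁) →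
    Y33 = (fun x => -(Y3 x + sl3 x * (X33 x - X3 x))) →
    Qf3 = (fun x => sl3 x / 2 + Y33 x / (2 * X33 x) - Y3 x / (2 * X3 x)) →
    Pg = (fun x => 4 * (x + 2 * x₁) * y₁ - L₁ * (4 * x ^ 2 + 4 * x * x₁ + 4 * x₁ ^ 2 - g₂)
      + 4 * (x + 2 * x₁) * yb x) →
    G = (fun x => Pg x / (yb x + y₁) ^ 2 * Real.sqrt (x * X33 x) / X3 x) →
    (∀ x, 0 < f x → yb x + y₁ ≠ 0 → Y3 x + y₁ ≠ 0 → 0 < X3 x → 0 < X33 x → 0 < x → Pg x ≠ 0 →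
      HasDerivAt G (G x * ((Qf3 x - Qf x) / yb x)) x ∧ G x ≠ 0) ∧
    (∀ x, (4 * (x + 2 * x₁) * y₁ - L₁ * (4 * x ^ 2 + 4 * x * x₁ + 4 * x₁ ^ 2 - g₂)) ^ 2
        - (4 * (x + 2 * x₁)) ^ 2 * f x = -4 * (x - x₂) * (4 * x ^ 2 + 4 * x * x₁ + 4 * x₁ ^ 2 - g₂) ^ 2) ∧
    (4 * (x₂ + 2 * x₁) * y₁ - L₁ * (4 * x₂ ^ 2 + 4 * x₂ * x₁ + 4 * x₁ ^ 2 - g₂) = 4 * (x₂ + 2 * x₁) * y₂) ∧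
    y₂ ^ 2 = f x₂ := by
  intro g₂ g₃ x₁ y₁ x₂ y₂ L₁ ε f yb sl X3 Y3 Qf sl3 X33 Y33 Qf3 Pg G hf h1 hy₁ hε hL hx₂ hy₂ hyb hsl
    hX3 hY3 hQf hsl3 hX33 hY33 hQf3 hPg hG
  have h1' : y₁ ^ 2 = 4 * x₁ ^ 3 - g₂ * x₁ - g₃ := by rw [← hf]; exact h1
  have hL2 : L₁ * (2 * y₁) = 12 * x₁ ^ 2 - g₂ := by
    rw [hL]; exact div_mul_cancel₀ _ (mul_ne_zero two_ne_zero hy₁)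
  refine ⟨?_, ?_, ?_, ?_⟩
  · intro x hfx hD hD3 hX3pos hX33pos hxpos hP
    -- the branch value `w = yb x` and its square
    have hεinv : ε⁻¹ = ε := by rcases hε with h | h <;> rw [h] <;> norm_num
    have hε2 : ε ^ 2 = 1 := by rcases hε with h | h <;> rw [h] <;> norm_num
    have hεne : ε ≠ 0 := by rcases hε with h | h <;> rw [h] <;> norm_num
    have hsqpos : 0 < Real.sqrt (f x) := Real.sqrt_pos.mpr hfx
    have hybx : yb x = ε * Real.sqrt (f x) := by rw [hyb]
    have hw0 : yb x ≠ 0 := by rw [hybx]; exact mul_ne_zero hεne hsqpos.ne'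
    have hwsq : yb x ^ 2 = f x := by
      rw [hybx, mul_pow, hε2, one_mul, Real.sq_sqrt hfx.le]
    have hw' : yb x ^ 2 = 4 * x ^ 3 - g₂ * x - g₃ := by rw [← hf]; exact hwsq
    have hwk : yb x * (yb x)⁻¹ = 1 := mul_inv_cancel₀ hw0
    -- derivative of the cubic and of the branch
    have hfd : HasDerivAt f (12 * x ^ 2 - g₂) x := by
      rw [show f = fun t => 4 * t ^ 3 - g₂ * t - g₃ from funext hf]
      refine (((((hasDerivAt_id' x).fun_pow 3).const_mul 4).fun_sub
        ((hasDerivAt_id' x).const_mul g₂)).sub_const g₃).congr_deriv ?_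
      norm_num
      ring
    have hybd : HasDerivAt yb ((12 * x ^ 2 - g₂) / 2 * (yb x)⁻¹) x := by
      have h : HasDerivAt (fun t => ε * Real.sqrt (f t))
          (ε * ((12 * x ^ 2 - g₂) / (2 * Real.sqrt (f x)))) x := (hfd.sqrt hfx.ne').const_mul ε
      rw [hybx, hyb]
      refine h.congr_deriv ?_
      rw [mul_inv, hεinv]
      ring
    have hxx : HasDerivAt (fun t : ℝ => t) (yb x * (yb x)⁻¹) x := by
      rw [hwk]; exact hasDerivAt_id' x
    -- translation invariance of `dx/y`, twice
    obtain ⟨hon3, hX3d, hY3d⟩ := dlogPotential_chordStep g₂ g₃ x₁ y₁ (yb x)⁻¹ x f (fun t => t) yb sl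
      X3 Y3 hf h1 hsl hX3 hY3 hxx hybd hwsq hD
    obtain ⟨-, hX33d, -⟩ := dlogPotential_chordStep g₂ g₃ x₁ y₁ (yb x)⁻¹ x f X3 Y3 sl3 X33 Y33
      hf h1 hsl3 hX33 hY33 hX3d hY3d hon3 hD3
    -- derivative of `Pg`
    have hlin : HasDerivAt (fun t : ℝ => 4 * (t + 2 * x₁)) 4 x :=
      (((hasDerivAt_id' x).add_const (2 * x₁)).const_mul 4).congr_deriv (by ring)
    have hMx :
        HasDerivAt (fun t : ℝ => 4 * t ^ 2 + 4 * t * x₁ + 4 * x₁ ^ 2 - g₂) (8 * x + 4 * x₁) x :=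
      (hasDerivAt_chordM x₁ g₂ x 1 (fun t => t) (hasDerivAt_id' x)).congr_deriv (by ring)
    have hPgd : HasDerivAt Pg (4 * y₁ - L₁ * (8 * x + 4 * x₁)
        + (4 * yb x + 4 * (x + 2 * x₁) * ((12 * x ^ 2 - g₂) / 2 * (yb x)⁻¹))) x := by
      have h := ((hlin.mul_const y₁).fun_sub (hMx.const_mul L₁)).fun_add (hlin.fun_mul hybd)
      rw [hPg]
      refine h.congr_deriv ?_
      ring
    -- derivative of `G`
    have hD2d : HasDerivAt (fun t => (yb t + y₁) ^ 2)
        (2 * (yb x + y₁) * ((12 * x ^ 2 - g₂) / 2 * (yb x)⁻¹)) x := by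
      refine ((hybd.add_const y₁).fun_pow 2).congr_deriv ?_
      norm_num
    have hR0 : 0 < x * X33 x := mul_pos hxpos hX33pos
    have hRpos : 0 < Real.sqrt (x * X33 x) := Real.sqrt_pos.mpr hR0
    have hR2 : Real.sqrt (x * X33 x) ^ 2 = x * X33 x := Real.sq_sqrt hR0.le
    have hRd : HasDerivAt (fun t => Real.sqrt (t * X33 t))
        ((1 * X33 x + x * (Y33 x * (yb x)⁻¹)) / (2 * Real.sqrt (x * X33 x))) x :=
      ((hasDerivAt_id' x).fun_mul hX33d).sqrt hR0.ne'
    have hGd := ((hPgd.fun_div hD2d (pow_ne_zero 2 hD)).fun_mul hRd).fun_div hX3d hX3pos.ne'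
    have hGx : G x = Pg x / (yb x + y₁) ^ 2 * Real.sqrt (x * X33 x) / X3 x := by rw [hG]
    refine ⟨?_, ?_⟩
    swap
    · rw [hGx]
      exact div_ne_zero (mul_ne_zero (div_ne_zero hP (pow_ne_zero 2 hD)) hRpos.ne') hX3pos.ne'
    rw [hGx, hG]
    refine hGd.congr_deriv ?_
    -- pointwise values
    have hslx' : sl x = (4 * x ^ 2 + 4 * x * x₁ + 4 * x₁ ^ 2 - g₂) / (yb x + y₁) := by rw [hsl]
    have hslx : sl x * (yb x + y₁) = 4 * x ^ 2 + 4 * x * x₁ + 4 * x₁ ^ 2 - g₂ := by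
      rw [hslx']; exact div_mul_cancel₀ _ hD
    have hX3x : X3 x = sl x ^ 2 / 4 - x - x₁ := by rw [hX3]
    have hY3x : Y3 x = -(yb x + sl x * (X3 x - x)) := by rw [hY3]
    have hsl3x' : sl3 x = (4 * X3 x ^ 2 + 4 * X3 x * x₁ + 4 * x₁ ^ 2 - g₂) / (Y3 x + y₁) := by
      rw [hsl3]
    have hsl3x : sl3 x * (Y3 x + y₁) = 4 * X3 x ^ 2 + 4 * X3 x * x₁ + 4 * x₁ ^ 2 - g₂ := by
      rw [hsl3x']; exact div_mul_cancel₀ _ hD3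
    have hQfx : Qf x = sl x / 2 + Y3 x / (2 * X3 x) - yb x / (2 * x) := by rw [hQf]
    have hQf3x : Qf3 x = sl3 x / 2 + Y33 x / (2 * X33 x) - Y3 x / (2 * X3 x) := by rw [hQf3]
    have hPx : Pg x = 4 * (x + 2 * x₁) * y₁ - L₁ * (4 * x ^ 2 + 4 * x * x₁ + 4 * x₁ ^ 2 - g₂)
        + 4 * (x + 2 * x₁) * yb x := by rw [hPg]
    have hon3' : Y3 x ^ 2 = 4 * X3 x ^ 3 - g₂ * X3 x - g₃ := by rw [← hf]; exact hon3
    -- (F1) the abscissa of the sum point against `x₁`: `2 (w + y₁)² (X3 - x₁) = -y₁ Pg`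
    have hF1 : 2 * (yb x + y₁) ^ 2 * (X3 x - x₁) = -(y₁ * Pg x) := by
      rw [hX3x, hPx]
      linear_combination
        (sl x * (yb x + y₁) + (4 * x ^ 2 + 4 * x * x₁ + 4 * x₁ ^ 2 - g₂)) / 2 * hslx
        - 2 * (x + 2 * x₁) * hw' + 2 * (x + 2 * x₁) * h1'
        - (4 * x ^ 2 + 4 * x * x₁ + 4 * x₁ ^ 2 - g₂) / 2 * hL2
    have h2D : (2 * (yb x + y₁) ^ 2) ≠ 0 := mul_ne_zero two_ne_zero (pow_ne_zero 2 hD)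
    have hXx1 : X3 x - x₁ = -(y₁ * Pg x) / (2 * (yb x + y₁) ^ 2) := by
      rw [eq_div_iff h2D]; linear_combination hF1
    have hXne : X3 x - x₁ ≠ 0 := by
      rw [hXx1]; exact div_ne_zero (neg_ne_zero.mpr (mul_ne_zero hy₁ hP)) h2D
    -- (F3) the chord through `(x, w)` and `P₁`: `sl (X3 - x₁) = -Y3 - y₁`
    have hF3 : sl x * (X3 x - x₁) = -Y3 x - y₁ := by
      have h : (yb x + y₁) * (sl x * (X3 x - x₁) - (yb x + sl x * (X3 x - x) - y₁)) = 0 := by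
        linear_combination (x - x₁) * hslx - hw' + h1'
      have h' := (mul_eq_zero.mp h).resolve_left hD
      rw [hY3x]; linear_combination h'
    -- (F2) the chord through `(X3, Y3)` and `P₁`: `sl3 (X3 - x₁) = Y3 - y₁`
    have hF2 : sl3 x * (X3 x - x₁) = Y3 x - y₁ := by
      have h : sl3 x * (X3 x - x₁) * (Y3 x + y₁) = (Y3 x - y₁) * (Y3 x + y₁) := by
        linear_combination (X3 x - x₁) * hsl3x - hon3' + h1'
      exact mul_right_cancel₀ hD3 h
    have hs3diff : sl3 x - sl x = 2 * Y3 x / (X3 x - x₁) := by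
      rw [eq_div_iff hXne]; linear_combination hF2 - hF3
    -- (DY) clearing the denominators of `Y3`
    have hDY : (yb x + y₁) ^ 3 * Y3 x = -yb x * (yb x + y₁) ^ 3
        - (4 * x ^ 2 + 4 * x * x₁ + 4 * x₁ ^ 2 - g₂) ^ 3 / 4
        + (2 * x + x₁) * (4 * x ^ 2 + 4 * x * x₁ + 4 * x₁ ^ 2 - g₂) * (yb x + y₁) ^ 2 := by
      rw [hY3x, hX3x]
      linear_combination (-((sl x * (yb x + y₁)) ^ 2
          + sl x * (yb x + y₁) * (4 * x ^ 2 + 4 * x * x₁ + 4 * x₁ ^ 2 - g₂)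
          + (4 * x ^ 2 + 4 * x * x₁ + 4 * x₁ ^ 2 - g₂) ^ 2) / 4
        + (2 * x + x₁) * (yb x + y₁) ^ 2) * hslx
    -- (E) the residual identity, polynomial form
    have hE : y₁ * ((yb x * (4 * y₁ - L₁ * (8 * x + 4 * x₁)) + 4 * yb x ^ 2
          + 4 * (x + 2 * x₁) * (12 * x ^ 2 - g₂) / 2) * (yb x + y₁) - (12 * x ^ 2 - g₂) * Pg x)
        + 2 * (yb x + y₁) ^ 3 * Y3 x = 0 := by
      linear_combination (-y₁ * (12 * x ^ 2 - g₂)) * hPx + 2 * hDY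
        + (24 * x ^ 4 + 24 * x ^ 3 * x₁ + 24 * x ^ 2 * x₁ ^ 2 - 8 * x ^ 2 * g₂ - 4 * x * yb x ^ 2
            - 4 * x * yb x * y₁ - 2 * x * x₁ * g₂ - 2 * yb x ^ 2 * x₁ - 2 * yb x * x₁ * y₁
            - 2 * x₁ ^ 2 * g₂ + (1/2) * g₂ ^ 2) * hL2
        + (8 * x ^ 3 + 24 * x ^ 2 * x₁ - 24 * x * x₁ ^ 2 + 2 * x * g₂ - 2 * yb x ^ 2
            - 2 * yb x * y₁ - 16 * x₁ ^ 3 + 2 * y₁ ^ 2 + 2 * g₃) * hw'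
        + (-24 * x ^ 2 * x₁ + 24 * x * x₁ ^ 2 - 4 * x * g₂ + 2 * yb x * y₁ + 8 * x₁ ^ 3
            + 2 * x₁ * g₂ - 2 * g₃) * h1'
    -- the residual identity: `Pg'/Pg - 2 w'/(w + y₁) = (sl3 - sl)/(2 w)`
    have hwP : yb x * (4 * y₁ - L₁ * (8 * x + 4 * x₁)
          + (4 * yb x + 4 * (x + 2 * x₁) * ((12 * x ^ 2 - g₂) / 2 * (yb x)⁻¹)))
        = yb x * (4 * y₁ - L₁ * (8 * x + 4 * x₁)) + 4 * yb x ^ 2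
          + 4 * (x + 2 * x₁) * (12 * x ^ 2 - g₂) / 2 := by
      linear_combination (4 * (x + 2 * x₁) * (12 * x ^ 2 - g₂) / 2) * hwk
    have hww : yb x * ((12 * x ^ 2 - g₂) / 2 * (yb x)⁻¹) = (12 * x ^ 2 - g₂) / 2 := by
      linear_combination ((12 * x ^ 2 - g₂) / 2) * hwk
    have hres : 2 * yb x * ((4 * y₁ - L₁ * (8 * x + 4 * x₁)
          + (4 * yb x + 4 * (x + 2 * x₁) * ((12 * x ^ 2 - g₂) / 2 * (yb x)⁻¹))) / Pg x
          - 2 * ((12 * x ^ 2 - g₂) / 2 * (yb x)⁻¹) / (yb x + y₁))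
        = -(4 * (yb x + y₁) ^ 2 * Y3 x) / (y₁ * Pg x) := by
      have step : 2 * yb x * ((4 * y₁ - L₁ * (8 * x + 4 * x₁)
          + (4 * yb x + 4 * (x + 2 * x₁) * ((12 * x ^ 2 - g₂) / 2 * (yb x)⁻¹))) / Pg x
          - 2 * ((12 * x ^ 2 - g₂) / 2 * (yb x)⁻¹) / (yb x + y₁))
          = 2 * (yb x * (4 * y₁ - L₁ * (8 * x + 4 * x₁)
            + (4 * yb x + 4 * (x + 2 * x₁) * ((12 * x ^ 2 - g₂) / 2 * (yb x)⁻¹)))) / Pg x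
            - 4 * (yb x * ((12 * x ^ 2 - g₂) / 2 * (yb x)⁻¹)) / (yb x + y₁) := by ring
      rw [step, hwP, hww, div_sub_div _ _ hP hD,
        div_eq_div_iff (mul_ne_zero hP hD) (mul_ne_zero hy₁ hP)]
      linear_combination (2 * Pg x) * hE
    have hR1 : 2 * Y3 x / (X3 x - x₁) = -(4 * (yb x + y₁) ^ 2 * Y3 x) / (y₁ * Pg x) := by
      rw [hXx1, div_div_eq_mul_div,
        div_eq_div_iff (neg_ne_zero.mpr (mul_ne_zero hy₁ hP)) (mul_ne_zero hy₁ hP)]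
      ring
    have hs3 : sl3 x = sl x + 2 * yb x * ((4 * y₁ - L₁ * (8 * x + 4 * x₁)
          + (4 * yb x + 4 * (x + 2 * x₁) * ((12 * x ^ 2 - g₂) / 2 * (yb x)⁻¹))) / Pg x
          - 2 * ((12 * x ^ 2 - g₂) / 2 * (yb x)⁻¹) / (yb x + y₁)) := by
      linear_combination hs3diff + hR1 - hres
    -- assembly of the logarithmic derivatives
    rw [hQf3x, hQfx]
    linear_combination dlogPotential_assembly (Pg x) _ (yb x + y₁) (yb x) _
      (Real.sqrt (x * X33 x)) (X33 x) (Y33 x) (X3 x) (Y3 x) (sl x) (sl3 x) x hP hD hw0 hRpos.ne'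
      hX3pos.ne' hxpos.ne' hR2 hs3
  · -- (ii) the norm identity `A² - B² f = -4 (x - x₂) M²`
    intro x
    rw [hf]
    linear_combination (-4 * (4 * x ^ 2 + 4 * x * x₁ + 4 * x₁ ^ 2 - g₂) ^ 2) * hx₂
      + (-4 * (x + 2 * x₁) * (4 * x ^ 2 + 4 * x * x₁ + 4 * x₁ ^ 2 - g₂)) * hL2
      + (16 * (x + 2 * x₁) ^ 2) * h1'
  · -- (iii) `A(x₂) = B(x₂) y₂`
    linear_combination (-4 * (x₂ + 2 * x₁)) * hy₂ + 8 * y₁ * hx₂ + L₁ * hL2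
  · -- (iv) the tangential point `2P₁ = (x₂, y₂)` lies on the curve
    rw [hf, hy₂, hx₂]
    linear_combination (L₁ ^ 2 / 4 - 2 * x₁ - x₁) * hL2 + h1'

end Summit.KontsevichZagierPeriods.KontsevichZagierPeriods.Cruxes.NeronTorsionSector.Translation

end
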